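import Literature.Analysis.FluidPDE.LerayVolterraComparison
import Mathlib.Analysis.SpecialFunctions.Pow.Continuity
import Mathlib.MeasureTheory.Integral.Bochner.Set
import Mathlib.Topology.ContinuousOn
import HarnessLib

/-!
# The Abel transform `A[g](t) = ∫_{(t₀,t)} (t-τ)^{-1/2} g(τ) dτ` on bounded functions and the
  scalar Picard majorants of a linear Volterra equation

Analysis/ODE support file (pure real analysis, everything proved) for the linear step, in
forcing form, of the perturbation theorem of M. P. Coiculescu, S. Palasek, *Non-uniqueness of
smooth solutions of the Navier–Stokes equations from critical data*, Invent. Math. 244 (2025) =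
arXiv:2503.14699, Props. 4.2–4.3 (hypothesis `hB` of
`Literature.Barriers.NavierStokesRegularity.CriticalDataSmoothNonuniqueness_of_principalParts_of_perturbationThreshold`).
The sup norm `f(t) = ‖w(t)‖_∞` of a solution of the linearised problem
`w = Φ - B_{t₀}(v, w) - B_{t₀}(w, v)` on a time window `[t₀, T]` (`B` the Oseen–Duhamel
bilinear term, whose slices obey `‖e^{σΔ}ℙ∇·(a ⊗ b)‖_∞ ≤ C₀σ^{-1/2}‖a‖_∞‖b‖_∞`) obeys the
weakly singular Volterra inequality `f(t) ≤ φ(t) + L ∫_{t₀}^t (t-τ)^{-1/2} V(τ) f(τ) dτ`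
(`V(τ) ≥ ‖v(τ)‖_∞`, `φ(t) ≥ ‖Φ(t)‖_∞`), to which the fractional Grönwall lemma of the paper
(App. B, Lemma B.3) is applied — for CONTINUOUS `f`. This file provides the device that spares
the vector-valued theory every continuity consideration: the SCALAR Picard majorants
`B₀ = 0`, `B_{k+1} = φ + L A[V B_k]`, which dominate the vector Picard iterates slot by slot,
are continuous, non-negative and increasing in `k`, hence each `B_k ≤ B_{k+1} = φ + L A[V B_k]`
is itself a continuous sub-solution of the Volterra inequality; so any function `R` dominating
all continuous sub-solutions (Grönwall) dominates every `B_k`, hence the solution `w`.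

* `abelOp t₀ g t = ∫_{τ ∈ (t₀,t)} (t-τ)^{-1/2} g(τ) dτ` and its calculus on bounded measurable `g`:
  integrability of the integrand, the bound `|A[g](t)| ≤ 2M√(t-t₀)`, monotonicity, and the
  Hölder estimate `|A[g](t) - A[g](t')| ≤ 4M√(t-t')` (`abs_abelOp_sub_abelOp_le`), whence
  continuity on `[t₀, T]` (`continuousOn_abelOp`);
* `volterraMajorant t₀ T L φ V k` — the scalar Picard majorants, with
  `continuousOn_volterraMajorant`, `volterraMajorant_nonneg`, `volterraMajorant_mono`
  (increasing in `k`), `volterraMajorant_le_succ_apply` (the sub-solution property) and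
  `volterraMajorant_le_of_dominates` (domination by any `R` dominating continuous sub-solutions).

## Mathlib / tree search

Tree: `Literature.Analysis.FluidPDE.integrableOn_sub_rpow_Ioo`,
`Literature.Analysis.FluidPDE.setIntegral_Ioo_sub_rpow_neg_half`,
`Literature.Analysis.FluidPDE.measurable_sub_rpow_const` (`LerayVolterraComparison.lean`).
Mathlib: `MeasureTheory.norm_integral_le_of_norm_le`, `integral_mono_of_nonneg`,
`MeasureTheory.setIntegral_union`, `Metric.continuousOn_iff`.

## References

* M. P. Coiculescu, S. Palasek, Invent. Math. 244 (2025) = arXiv:2503.14699: proof of Prop. 4.2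
  (the Volterra inequality for `h(t) = t^{1/2}‖S(t,t')a‖_∞`) and App. B (Prop. B.1: the
  linearised problem; Lemma B.3). [`CoiculescuPalasek2025`]
-/

noncomputable section

open MeasureTheory Set Filter
open _root_.Topology

namespace Literature.Analysis.ODE

open Literature.Analysis.FluidPDE

/-! ### The Abel transform on bounded measurable functions -/

/-- **The Abel transform** from `t₀` with kernel `(t-τ)^{-1/2}`:
`A[g](t) = ∫_{τ ∈ (t₀, t)} (t - τ)^{-1/2} g(τ) dτ` (Bochner integral; `0` for `t ≤ t₀`). [folklore] -/
def abelOp (t₀ : ℝ) (g : ℝ → ℝ) (t : ℝ) : ℝ :=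
  ∫ τ in Ioo t₀ t, (t - τ) ^ (-(1 / 2 : ℝ)) * g τ

/-- Unfolding `abelOp`. [folklore] -/
theorem abelOp_apply (t₀ : ℝ) (g : ℝ → ℝ) (t : ℝ) :
    abelOp t₀ g t = ∫ τ in Ioo t₀ t, (t - τ) ^ (-(1 / 2 : ℝ)) * g τ := rfl

/-- `A[g](t) = 0` for `t ≤ t₀`. [folklore] -/
theorem abelOp_of_le {t₀ t : ℝ} (g : ℝ → ℝ) (h : t ≤ t₀) : abelOp t₀ g t = 0 := by
  rw [abelOp_apply, Ioo_eq_empty (not_lt.2 h), Measure.restrict_empty, integral_zero_measure]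

/-- The Abel kernel is non-negative on `(t₀, t)`. [folklore] -/
theorem abelKernel_nonneg {t τ : ℝ} (hτ : τ ≤ t) : 0 ≤ (t - τ) ^ (-(1 / 2 : ℝ)) :=
  Real.rpow_nonneg (sub_nonneg.2 hτ) _

/-- **Integrability of the Abel integrand** `(t-τ)^{-1/2} g(τ)` on `(t₀, t)` for `g`
a.e.-strongly measurable and bounded by `M` on `(t₀, t)`. [folklore] -/
theorem integrableOn_abelKernel_mul {t₀ t M : ℝ} {g : ℝ → ℝ}
    (hgm : AEStronglyMeasurable g (volume.restrict (Ioo t₀ t)))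
    (hgM : ∀ τ ∈ Ioo t₀ t, |g τ| ≤ M) :
    IntegrableOn (fun τ => (t - τ) ^ (-(1 / 2 : ℝ)) * g τ) (Ioo t₀ t) := by
  have hk : IntegrableOn (fun τ : ℝ => (t - τ) ^ (-(1 / 2 : ℝ))) (Ioo t₀ t) :=
    integrableOn_sub_rpow_Ioo (by norm_num)
  refine Integrable.mono' (hk.norm.mul_const M) ?_ ?_
  · exact ((measurable_sub_rpow_const t _).aestronglyMeasurable.restrict).mul hgm
  · filter_upwards [ae_restrict_mem measurableSet_Ioo] with τ hτ
    simp only [norm_mul, Real.norm_eq_abs]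
    exact mul_le_mul_of_nonneg_left (hgM τ hτ) (abs_nonneg _)

/-- **Sup bound** `|A[g](t)| ≤ M · 2√(t - t₀)` for `|g| ≤ M` on `(t₀, t)`, `t₀ ≤ t` (no
measurability needed). [folklore] -/
theorem abs_abelOp_le {t₀ t M : ℝ} {g : ℝ → ℝ} (ht : t₀ ≤ t) (hgM : ∀ τ ∈ Ioo t₀ t, |g τ| ≤ M) :
    |abelOp t₀ g t| ≤ M * (2 * Real.sqrt (t - t₀)) := by
  have hk : IntegrableOn (fun τ : ℝ => (t - τ) ^ (-(1 / 2 : ℝ))) (Ioo t₀ t) :=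
    integrableOn_sub_rpow_Ioo (by norm_num)
  rw [abelOp_apply, ← Real.norm_eq_abs]
  refine (norm_integral_le_of_norm_le (hk.mul_const M) ?_).trans (le_of_eq ?_)
  · filter_upwards [ae_restrict_mem measurableSet_Ioo] with τ hτ
    rw [norm_mul, Real.norm_eq_abs, Real.norm_eq_abs, abs_of_nonneg (abelKernel_nonneg hτ.2.le)]
    exact mul_le_mul_of_nonneg_left (hgM τ hτ) (abelKernel_nonneg hτ.2.le)
  · rw [integral_mul_const, Literature.Analysis.FluidPDE.setIntegral_Ioo_sub_rpow_neg_half ht,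
      ← Real.sqrt_eq_rpow]
    ring

/-- **Monotonicity of the Abel transform**: `0 ≤ g₁ ≤ g₂` on `(t₀, t)` with `g₂` measurable and
bounded there give `A[g₁](t) ≤ A[g₂](t)` (`integral_mono_of_nonneg`; no hypothesis on `g₁`).
[folklore] -/
theorem abelOp_mono {t₀ t M : ℝ} {g₁ g₂ : ℝ → ℝ}
    (hg₂m : AEStronglyMeasurable g₂ (volume.restrict (Ioo t₀ t)))
    (hg₂M : ∀ τ ∈ Ioo t₀ t, |g₂ τ| ≤ M) (h0 : ∀ τ ∈ Ioo t₀ t, 0 ≤ g₁ τ)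
    (hle : ∀ τ ∈ Ioo t₀ t, g₁ τ ≤ g₂ τ) : abelOp t₀ g₁ t ≤ abelOp t₀ g₂ t := by
  rw [abelOp_apply, abelOp_apply]
  refine integral_mono_of_nonneg ?_ (integrableOn_abelKernel_mul hg₂m hg₂M) ?_
  · filter_upwards [ae_restrict_mem measurableSet_Ioo] with τ hτ
    exact mul_nonneg (abelKernel_nonneg hτ.2.le) (h0 τ hτ)
  · filter_upwards [ae_restrict_mem measurableSet_Ioo] with τ hτ
    exact mul_le_mul_of_nonneg_left (hle τ hτ) (abelKernel_nonneg hτ.2.le)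

/-- `A[g](t) ≥ 0` for `g ≥ 0` on `(t₀, t)`. [folklore] -/
theorem abelOp_nonneg {t₀ t : ℝ} {g : ℝ → ℝ} (h0 : ∀ τ ∈ Ioo t₀ t, 0 ≤ g τ) : 0 ≤ abelOp t₀ g t :=
  setIntegral_nonneg measurableSet_Ioo fun τ hτ => mul_nonneg (abelKernel_nonneg hτ.2.le) (h0 τ hτ)

/-- The Abel transform only sees `g` on `(t₀, t)`. [folklore] -/
theorem abelOp_congr {t₀ t : ℝ} {g₁ g₂ : ℝ → ℝ} (h : ∀ τ ∈ Ioo t₀ t, g₁ τ = g₂ τ) :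
    abelOp t₀ g₁ t = abelOp t₀ g₂ t :=
  setIntegral_congr_fun measurableSet_Ioo fun τ hτ => by rw [h τ hτ]

/-- **Hölder continuity of the Abel transform**: for `t₀ ≤ t' ≤ t` and `g` measurable with
`|g| ≤ M` on `(t₀, t)`, `|A[g](t) - A[g](t')| ≤ 4M√(t - t')`. Split `(t₀, t) = (t₀, t'] ∪ (t', t)`:
on the second piece `∫ (t-τ)^{-1/2} M = 2M√(t-t')`; on the first the kernels differ by the
non-negative `(t'-τ)^{-1/2} - (t-τ)^{-1/2}`, whose integral is
`2(√(t'-t₀) - √(t-t₀) + √(t-t')) ≤ 2√(t-t')`. [folklore] -/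
theorem abs_abelOp_sub_abelOp_le {t₀ t' t M : ℝ} {g : ℝ → ℝ} (h₀ : t₀ ≤ t') (h₁ : t' ≤ t)
    (hgm : AEStronglyMeasurable g (volume.restrict (Ioo t₀ t)))
    (hgM : ∀ τ ∈ Ioo t₀ t, |g τ| ≤ M) :
    |abelOp t₀ g t - abelOp t₀ g t'| ≤ 4 * M * Real.sqrt (t - t') := by
  have hM : 0 ≤ M ∨ Ioo t₀ t = ∅ := by
    rcases (Ioo t₀ t).eq_empty_or_nonempty with h | ⟨τ, hτ⟩
    · exact Or.inr h
    · exact Or.inl ((abs_nonneg _).trans (hgM τ hτ))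
  rcases hM with hM | hempty
  swap
  · -- degenerate window: everything vanishes
    have htt : t ≤ t₀ := by
      by_contra hlt
      push Not at hlt
      obtain ⟨τ, hτ⟩ := nonempty_Ioo.2 hlt
      rw [hempty] at hτ
      exact hτ
    rw [abelOp_of_le g htt, abelOp_of_le g (h₁.trans htt), sub_zero, abs_zero,
      show t - t' = 0 by linarith, Real.sqrt_zero, mul_zero]
  -- kernels and their integrability
  set k : ℝ → ℝ := fun τ => (t - τ) ^ (-(1 / 2 : ℝ)) with hk
  set k' : ℝ → ℝ := fun τ => (t' - τ) ^ (-(1 / 2 : ℝ)) with hk'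
  have hkI : IntegrableOn k (Ioo t₀ t) := integrableOn_sub_rpow_Ioo (by norm_num)
  have hk'I : IntegrableOn k' (Ioo t₀ t') := integrableOn_sub_rpow_Ioo (by norm_num)
  have hgm' : AEStronglyMeasurable g (volume.restrict (Ioo t₀ t')) :=
    hgm.mono_measure (Measure.restrict_mono (Ioo_subset_Ioo le_rfl h₁) le_rfl)
  have hgM' : ∀ τ ∈ Ioo t₀ t', |g τ| ≤ M := fun τ hτ => hgM τ ⟨hτ.1, hτ.2.trans_le h₁⟩
  have hkgI : IntegrableOn (fun τ => k τ * g τ) (Ioo t₀ t) := integrableOn_abelKernel_mul hgm hgM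
  have hk'gI : IntegrableOn (fun τ => k' τ * g τ) (Ioo t₀ t') :=
    integrableOn_abelKernel_mul hgm' hgM'
  -- split the integral defining `A[g](t)` at `t'`
  have hsplit : abelOp t₀ g t =
      (∫ τ in Ioo t₀ t', k τ * g τ) + ∫ τ in Ico t' t, k τ * g τ := by
    rw [abelOp_apply]
    rcases h₀.eq_or_lt with heq | hlt
    · subst heq
      rw [Ioo_self, Measure.restrict_empty, integral_zero_measure, zero_add,
        setIntegral_congr_set (Ioo_ae_eq_Ico (μ := (volume : Measure ℝ)))]
    have hdisj : Disjoint (Ioo t₀ t') (Ico t' t) :=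
      (Set.Iio_disjoint_Ici le_rfl).mono Ioo_subset_Iio_self Ico_subset_Ici_self
    rw [← Ioo_union_Ico_eq_Ioo hlt h₁, setIntegral_union hdisj measurableSet_Ico
      (hkgI.mono_set (Ioo_subset_Ioo le_rfl h₁)) (hkgI.mono_set (Ico_subset_Ioo_left hlt))]
  -- piece on `[t', t)`: bounded by `2 M √(t - t')`
  have hpiece₂ : |∫ τ in Ico t' t, k τ * g τ| ≤ M * (2 * Real.sqrt (t - t')) := by
    rw [setIntegral_congr_set (Ioo_ae_eq_Ico (μ := (volume : Measure ℝ))).symm]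
    exact abs_abelOp_le h₁ fun τ hτ => hgM τ ⟨h₀.trans_lt hτ.1, hτ.2⟩
  -- piece on `(t₀, t')`: the kernel difference
  have hdiffI : IntegrableOn (fun τ => (k' τ - k τ) * g τ) (Ioo t₀ t') := by
    have h := hk'gI.sub (hkgI.mono_set (Ioo_subset_Ioo le_rfl h₁))
    refine h.congr (Eventually.of_forall fun τ => ?_)
    simp only [Pi.sub_apply]
    ring
  have hker_le : ∀ τ ∈ Ioo t₀ t', k τ ≤ k' τ := fun τ hτ =>
    Real.rpow_le_rpow_of_nonpos (sub_pos.2 hτ.2) (by linarith) (by norm_num)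
  have hpiece₁ : |(∫ τ in Ioo t₀ t', k' τ * g τ) - ∫ τ in Ioo t₀ t', k τ * g τ| ≤
      M * (2 * Real.sqrt (t - t')) := by
    rw [← integral_sub hk'gI (hkgI.mono_set (Ioo_subset_Ioo le_rfl h₁))]
    have heq : (fun τ => k' τ * g τ - k τ * g τ) = fun τ => (k' τ - k τ) * g τ := by
      funext τ; ring
    rw [heq, ← Real.norm_eq_abs]
    have hbound : IntegrableOn (fun τ => (k' τ - k τ) * M) (Ioo t₀ t') :=
      (hk'I.sub (hkI.mono_set (Ioo_subset_Ioo le_rfl h₁))).mul_const M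
    refine (norm_integral_le_of_norm_le hbound ?_).trans ?_
    · filter_upwards [ae_restrict_mem measurableSet_Ioo] with τ hτ
      have hd : 0 ≤ k' τ - k τ := sub_nonneg.2 (hker_le τ hτ)
      rw [norm_mul, Real.norm_eq_abs, Real.norm_eq_abs, abs_of_nonneg hd]
      exact mul_le_mul_of_nonneg_left (hgM' τ hτ) hd
    · rw [integral_mul_const, integral_sub hk'I (hkI.mono_set (Ioo_subset_Ioo le_rfl h₁))]
      -- `∫_{(t₀,t')} k' = 2√(t'-t₀)`, `∫_{(t₀,t')} k = 2(√(t-t₀) - √(t-t'))`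
      have e1 : ∫ τ in Ioo t₀ t', k' τ = 2 * Real.sqrt (t' - t₀) := by
        rw [Literature.Analysis.FluidPDE.setIntegral_Ioo_sub_rpow_neg_half h₀, ← Real.sqrt_eq_rpow]
      have e2 : ∫ τ in Ioo t₀ t', k τ = 2 * (Real.sqrt (t - t₀) - Real.sqrt (t - t')) := by
        simp only [hk]
        rw [← integral_Ioc_eq_integral_Ioo, ← intervalIntegral.integral_of_le h₀,
          intervalIntegral.integral_comp_sub_left (fun s : ℝ => s ^ (-(1 / 2 : ℝ))) t,
          integral_rpow (Or.inl (by norm_num))]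
        have h1 : (-(1 / 2 : ℝ)) + 1 = 1 / 2 := by norm_num
        rw [h1, ← Real.sqrt_eq_rpow, ← Real.sqrt_eq_rpow]
        ring
      rw [e1, e2]
      have hsq : Real.sqrt (t - t₀) ≥ Real.sqrt (t' - t₀) := Real.sqrt_le_sqrt (by linarith)
      nlinarith [Real.sqrt_nonneg (t - t')]
  -- assemble
  have hA' : abelOp t₀ g t' = ∫ τ in Ioo t₀ t', k' τ * g τ := rfl
  calc |abelOp t₀ g t - abelOp t₀ g t'|
      = |((∫ τ in Ioo t₀ t', k τ * g τ) - ∫ τ in Ioo t₀ t', k' τ * g τ) +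
          ∫ τ in Ico t' t, k τ * g τ| := by rw [hsplit, hA']; ring_nf
    _ ≤ |(∫ τ in Ioo t₀ t', k τ * g τ) - ∫ τ in Ioo t₀ t', k' τ * g τ| +
          |∫ τ in Ico t' t, k τ * g τ| := abs_add_le _ _
    _ ≤ M * (2 * Real.sqrt (t - t')) + M * (2 * Real.sqrt (t - t')) := by
        rw [abs_sub_comm]
        exact add_le_add hpiece₁ hpiece₂
    _ = 4 * M * Real.sqrt (t - t') := by ring

/-- **Continuity of the Abel transform** on `[t₀, T]` for `g` measurable and bounded on `(t₀, T)`
(from the Hölder estimate `abs_abelOp_sub_abelOp_le`). [folklore] -/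
theorem continuousOn_abelOp {t₀ T M : ℝ} {g : ℝ → ℝ}
    (hgm : AEStronglyMeasurable g (volume.restrict (Ioo t₀ T)))
    (hgM : ∀ τ ∈ Ioo t₀ T, |g τ| ≤ M) : ContinuousOn (abelOp t₀ g) (Icc t₀ T) := by
  have hM0 : 0 ≤ 4 * |M| + 1 := by positivity
  -- the Hölder estimate between any two points of the interval
  have key : ∀ a ∈ Icc t₀ T, ∀ b ∈ Icc t₀ T, a ≤ b →
      |abelOp t₀ g b - abelOp t₀ g a| ≤ 4 * |M| * Real.sqrt (b - a) := by
    intro a ha b hb hab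
    have hgm' : AEStronglyMeasurable g (volume.restrict (Ioo t₀ b)) :=
      hgm.mono_measure (Measure.restrict_mono (Ioo_subset_Ioo le_rfl hb.2) le_rfl)
    have hgM' : ∀ τ ∈ Ioo t₀ b, |g τ| ≤ |M| := fun τ hτ =>
      (hgM τ ⟨hτ.1, hτ.2.trans_le hb.2⟩).trans (le_abs_self M)
    exact abs_abelOp_sub_abelOp_le ha.1 hab hgm' hgM'
  rw [Metric.continuousOn_iff]
  intro a ha ε hε
  refine ⟨(ε / (4 * |M| + 1)) ^ 2, by positivity, fun b hb hab => ?_⟩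
  rw [Real.dist_eq] at hab ⊢
  have hδ : Real.sqrt |b - a| < ε / (4 * |M| + 1) := by
    rw [Real.sqrt_lt' (by positivity)]
    exact hab
  have hbound : 4 * |M| * Real.sqrt |b - a| < ε := by
    calc 4 * |M| * Real.sqrt |b - a| ≤ (4 * |M| + 1) * Real.sqrt |b - a| := by
          gcongr; linarith
      _ < (4 * |M| + 1) * (ε / (4 * |M| + 1)) := by gcongr
      _ = ε := mul_div_cancel₀ ε (by positivity)
  rcases le_total a b with h | h
  · have := key a ha b hb h
    rw [abs_of_nonneg (sub_nonneg.2 h)] at hbound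
    exact this.trans_lt hbound
  · have := key b hb a ha h
    rw [abs_sub_comm] at this
    rw [abs_of_nonpos (sub_nonpos.2 h), neg_sub] at hbound
    exact this.trans_lt hbound

/-! ### The scalar Picard majorants -/

/-- **Scalar Picard majorants** of the linear Volterra equation
`B = φ + L A[V B]` on `[t₀, T]`: `B₀ = 0`, `B_{k+1}(t) = φ(t) + L A[𝟙_{(t₀,T]} V B_k](t)` (the
indicator makes the integrand a bounded measurable function on the line; it is invisible for
`t ≤ T`). They dominate the Picard iterates of the vector-valued linearised problem of
Coiculescu–Palasek (App. B, Prop. B.1) slot by slot. [cite: CoiculescuPalasek2025, App. B, Prop. B.1 and proof of Prop. 4.2] -/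
def volterraMajorant (t₀ T L : ℝ) (φ V : ℝ → ℝ) : ℕ → ℝ → ℝ
  | 0 => fun _ => 0
  | k + 1 => fun t =>
      φ t + L * abelOp t₀ ((Ioc t₀ T).indicator fun τ => V τ * volterraMajorant t₀ T L φ V k τ) t

/-- `B₀ = 0`. [folklore] -/
@[simp]
theorem volterraMajorant_zero (t₀ T L : ℝ) (φ V : ℝ → ℝ) (t : ℝ) :
    volterraMajorant t₀ T L φ V 0 t = 0 := rfl

/-- The recursion `B_{k+1}(t) = φ(t) + L A[𝟙 V B_k](t)`. [folklore] -/
theorem volterraMajorant_succ (t₀ T L : ℝ) (φ V : ℝ → ℝ) (k : ℕ) (t : ℝ) :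
    volterraMajorant t₀ T L φ V (k + 1) t =
      φ t + L * abelOp t₀
        ((Ioc t₀ T).indicator fun τ => V τ * volterraMajorant t₀ T L φ V k τ) t := rfl

section Majorant

variable {t₀ T L : ℝ} {φ V : ℝ → ℝ}

/-- A function continuous on `[t₀, T]` is bounded there in absolute value. [folklore] -/
theorem exists_abs_le_of_continuousOn_Icc {f : ℝ → ℝ} (hf : ContinuousOn f (Icc t₀ T)) :
    ∃ M : ℝ, ∀ t ∈ Icc t₀ T, |f t| ≤ M := by
  obtain ⟨M, hM⟩ := isCompact_Icc.exists_bound_of_continuousOn hf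
  exact ⟨M, fun t ht => by simpa [Real.norm_eq_abs] using hM t ht⟩

/-- The indicator integrand `𝟙_{(t₀,T]} (V · f)` of the recursion is a.e.-strongly measurable on
every `(t₀, t)` when `V`, `f` are continuous on `[t₀, T]`. [folklore] -/
theorem aestronglyMeasurable_indicator_mul {f : ℝ → ℝ} (hV : ContinuousOn V (Icc t₀ T))
    (hf : ContinuousOn f (Icc t₀ T)) (t : ℝ) :
    AEStronglyMeasurable ((Ioc t₀ T).indicator fun τ => V τ * f τ)
      (volume.restrict (Ioo t₀ t)) := by
  have hm : AEStronglyMeasurable (fun τ => V τ * f τ) (volume.restrict (Ioc t₀ T)) := by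
    have hc : ContinuousOn (fun τ => V τ * f τ) (Ioc t₀ T) :=
      (hV.mul hf).mono Ioc_subset_Icc_self
    exact hc.aestronglyMeasurable measurableSet_Ioc
  have h : AEStronglyMeasurable ((Ioc t₀ T).indicator fun τ => V τ * f τ) volume :=
    (aestronglyMeasurable_indicator_iff measurableSet_Ioc).2 hm
  exact h.restrict

/-- The indicator integrand is bounded on the line by the bound of `|V f|` on `[t₀, T]`.
[folklore] -/
theorem abs_indicator_mul_le {f : ℝ → ℝ} {M : ℝ} (hM : ∀ τ ∈ Icc t₀ T, |V τ * f τ| ≤ M)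
    (hM0 : 0 ≤ M) (τ : ℝ) : |(Ioc t₀ T).indicator (fun τ => V τ * f τ) τ| ≤ M := by
  by_cases hτ : τ ∈ Ioc t₀ T
  · rw [indicator_of_mem hτ]; exact hM τ (Ioc_subset_Icc_self hτ)
  · rw [indicator_of_notMem hτ, abs_zero]; exact hM0

/-- **The majorants are continuous on `[t₀, T]`** (induction: `φ` is continuous and the Abel
transform of the bounded measurable `𝟙 V B_k` is continuous, `continuousOn_abelOp`).
[cite: CoiculescuPalasek2025, App. B, Prop. B.1] -/
theorem continuousOn_volterraMajorant (hφ : ContinuousOn φ (Icc t₀ T))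
    (hV : ContinuousOn V (Icc t₀ T)) (k : ℕ) :
    ContinuousOn (volterraMajorant t₀ T L φ V k) (Icc t₀ T) := by
  induction k with
  | zero => exact continuousOn_const
  | succ k ih =>
    obtain ⟨M, hM⟩ := exists_abs_le_of_continuousOn_Icc (hV.mul ih)
    have hM0 : 0 ≤ M ∨ ∀ τ, τ ∉ Icc t₀ T := by
      by_cases h : (Icc t₀ T).Nonempty
      · obtain ⟨τ, hτ⟩ := h
        exact Or.inl ((abs_nonneg _).trans (hM τ hτ))
      · exact Or.inr fun τ hτ => h ⟨τ, hτ⟩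
    have hbd : ∀ τ ∈ Ioo t₀ T,
        |(Ioc t₀ T).indicator (fun τ => V τ * volterraMajorant t₀ T L φ V k τ) τ| ≤ |M| := by
      intro τ hτ
      rw [indicator_of_mem (Ioo_subset_Ioc_self hτ)]
      exact (hM τ (Ioo_subset_Icc_self hτ)).trans (le_abs_self M)
    have hA := continuousOn_abelOp (aestronglyMeasurable_indicator_mul hV ih T) hbd
    show ContinuousOn (fun t => φ t + L * abelOp t₀
      ((Ioc t₀ T).indicator fun τ => V τ * volterraMajorant t₀ T L φ V k τ) t) (Icc t₀ T)
    exact hφ.add (continuousOn_const.mul hA)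

/-- **The majorants are non-negative on `[t₀, T]`** for `φ, V ≥ 0` there and `L ≥ 0`.
[cite: CoiculescuPalasek2025, App. B, Prop. B.1] -/
theorem volterraMajorant_nonneg (hL : 0 ≤ L) (hφ0 : ∀ t ∈ Icc t₀ T, 0 ≤ φ t)
    (hV0 : ∀ t ∈ Icc t₀ T, 0 ≤ V t) (k : ℕ) :
    ∀ t ∈ Icc t₀ T, 0 ≤ volterraMajorant t₀ T L φ V k t := by
  induction k with
  | zero => intro t _; simp
  | succ k ih =>
    intro t ht
    rw [volterraMajorant_succ]
    refine add_nonneg (hφ0 t ht) (mul_nonneg hL (abelOp_nonneg fun τ hτ => ?_))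
    have hτ' : τ ∈ Ioc t₀ T := ⟨hτ.1, hτ.2.le.trans ht.2⟩
    rw [indicator_of_mem hτ']
    exact mul_nonneg (hV0 τ (Ioc_subset_Icc_self hτ')) (ih τ (Ioc_subset_Icc_self hτ'))

/-- **The majorants increase with `k`** on `[t₀, T]` (`B₁ = φ ≥ 0 = B₀`, and the recursion is
monotone because the kernel, `V` and `L` are non-negative). [cite: CoiculescuPalasek2025, App. B, Prop. B.1] -/
theorem volterraMajorant_le_succ (hL : 0 ≤ L) (hφ : ContinuousOn φ (Icc t₀ T))
    (hV : ContinuousOn V (Icc t₀ T)) (hφ0 : ∀ t ∈ Icc t₀ T, 0 ≤ φ t)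
    (hV0 : ∀ t ∈ Icc t₀ T, 0 ≤ V t) (k : ℕ) :
    ∀ t ∈ Icc t₀ T, volterraMajorant t₀ T L φ V k t ≤ volterraMajorant t₀ T L φ V (k + 1) t := by
  induction k with
  | zero =>
    intro t ht
    rw [volterraMajorant_zero]
    exact volterraMajorant_nonneg hL hφ0 hV0 1 t ht
  | succ k ih =>
    intro t ht
    rw [volterraMajorant_succ, volterraMajorant_succ]
    refine add_le_add le_rfl (mul_le_mul_of_nonneg_left ?_ hL)
    -- monotonicity of the Abel transform, with the bounded measurable upper integrand
    obtain ⟨M, hM⟩ := exists_abs_le_of_continuousOn_Icc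
      (hV.mul (continuousOn_volterraMajorant hφ hV (k + 1)))
    refine abelOp_mono (M := |M|)
      (aestronglyMeasurable_indicator_mul hV (continuousOn_volterraMajorant hφ hV (k + 1)) t)
      (fun τ hτ => ?_) (fun τ hτ => ?_) (fun τ hτ => ?_)
    · have hτ' : τ ∈ Ioc t₀ T := ⟨hτ.1, hτ.2.le.trans ht.2⟩
      rw [indicator_of_mem hτ']
      exact (hM τ (Ioc_subset_Icc_self hτ')).trans (le_abs_self M)
    · have hτ' : τ ∈ Ioc t₀ T := ⟨hτ.1, hτ.2.le.trans ht.2⟩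
      rw [indicator_of_mem hτ']
      exact mul_nonneg (hV0 τ (Ioc_subset_Icc_self hτ'))
        (volterraMajorant_nonneg hL hφ0 hV0 k τ (Ioc_subset_Icc_self hτ'))
    · have hτ' : τ ∈ Ioc t₀ T := ⟨hτ.1, hτ.2.le.trans ht.2⟩
      rw [indicator_of_mem hτ', indicator_of_mem hτ']
      exact mul_le_mul_of_nonneg_left (ih τ (Ioc_subset_Icc_self hτ'))
        (hV0 τ (Ioc_subset_Icc_self hτ'))

/-- **Each majorant is a continuous sub-solution**: `B_k(t) ≤ φ(t) + L A[V B_k](t)` on `[t₀, T]`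
(since `B_k ≤ B_{k+1}`; for `t ≤ T` the indicator is invisible on `(t₀, t)`).
[cite: CoiculescuPalasek2025, App. B, Prop. B.1] -/
theorem volterraMajorant_le_apply (hL : 0 ≤ L) (hφ : ContinuousOn φ (Icc t₀ T))
    (hV : ContinuousOn V (Icc t₀ T)) (hφ0 : ∀ t ∈ Icc t₀ T, 0 ≤ φ t)
    (hV0 : ∀ t ∈ Icc t₀ T, 0 ≤ V t) (k : ℕ) {t : ℝ} (ht : t ∈ Icc t₀ T) :
    volterraMajorant t₀ T L φ V k t ≤
      φ t + L * abelOp t₀ (fun τ => V τ * volterraMajorant t₀ T L φ V k τ) t := by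
  have h := volterraMajorant_le_succ hL hφ hV hφ0 hV0 k t ht
  rw [volterraMajorant_succ] at h
  refine h.trans_eq ?_
  congr 2
  refine abelOp_congr fun τ hτ => ?_
  have hτ' : τ ∈ Ioc t₀ T := ⟨hτ.1, hτ.2.le.trans ht.2⟩
  exact indicator_of_mem hτ' _

/-- **Domination of the majorants.** If `R` dominates every continuous non-negative
sub-solution of `B ≤ φ + L A[V B]` on `[t₀, T]` (this is what a Grönwall lemma provides), then
`B_k ≤ R` on `[t₀, T]` for every `k`. [cite: CoiculescuPalasek2025, App. B, Prop. B.1 with Lemma B.3] -/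
theorem volterraMajorant_le_of_dominates (hL : 0 ≤ L) (hφ : ContinuousOn φ (Icc t₀ T))
    (hV : ContinuousOn V (Icc t₀ T)) (hφ0 : ∀ t ∈ Icc t₀ T, 0 ≤ φ t)
    (hV0 : ∀ t ∈ Icc t₀ T, 0 ≤ V t) {R : ℝ → ℝ}
    (hR : ∀ B : ℝ → ℝ, ContinuousOn B (Icc t₀ T) → (∀ t ∈ Icc t₀ T, 0 ≤ B t) →
      (∀ t ∈ Icc t₀ T, B t ≤ φ t + L * abelOp t₀ (fun τ => V τ * B τ) t) →
      ∀ t ∈ Icc t₀ T, B t ≤ R t)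
    (k : ℕ) : ∀ t ∈ Icc t₀ T, volterraMajorant t₀ T L φ V k t ≤ R t :=
  hR _ (continuousOn_volterraMajorant hφ hV k) (volterraMajorant_nonneg hL hφ0 hV0 k)
    fun _ ht => volterraMajorant_le_apply hL hφ hV hφ0 hV0 k ht

end Majorant

end Literature.Analysis.ODE
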